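import Summits.QuantumFields.BalabanUV.Beta.GAN24.DerivativeItemPlantedLaw

/-!
# `BalabanUV.Beta.GAN24.NestedBackgroundWordRate` — binder row G-an2-4 ∕ (CONV-C), routes C-R6° («VALUES») × R7 («TWO CURRENCIES»), PART 219:
# (L-SR) FOR BOUNDED NESTED BACKGROUNDS — the insertion word `X_{i,k} = avgTow(𝒢_k·diag(V^{(k)})∇^{(k)}_{μ₀}·𝒢_k)` of a BOUNDED single-direction background that is EXACTLY
# NESTED (`V^{(k+1)} = V^{(k)} ∘ par`: e.g. the indicator of a union of unit blocks — row an1's coordinate 1-forms `1_{block x}`) converges along Bałaban's tower with rate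
# `L^{−k}` in OPERATOR norm, hence has PART 198's two leg envelopes — (L-UD) `B·e^{−κ(distK x i + distK y i)}` and (L-SR) `B′·(√(L⁻¹))^k·e^{−κ(…)}` — WITHOUT ANY LIPSCHITZ LETTER:
# census V202′ (b′) CLOSED for nested block indicators (unit b2b-balaban-gan24-p3, gen 63; v1)

NOT IN PRINT; OUR PROOF ([folklore] bookkeeping BY NAME over PART 217 (`towerLimitRate_plantedWord`), PART 218 (`plantedG_le_lev`, `plantedW_le_lev`, `pairingW_le_lev`), PART 198
(`exists_twoPoint_insertion` — bounded (L-UD), no smoothness), the t4-ne2-p1 lineage's `BalabanAveragingPairing.freeTowerLaws_balaban`, `KingPairingPlantedLaw` (`JpcT`, `calDalev`,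
`calDalev_inv`, `JK_conjTranspose_mul_JK`, `CJ`), `BlockPairingGeometry` (`parT`, `JK_mul_diagonal`, `opNorm_diagonal_le`), `DecayRateInterpolation.decayRate_of_towerLimitRate`,
b05's `B5Prop11Plancherel` (`opNorm_calG_le`, `opNorm_fdiff_calG_le`); [Balaban1984PropagatorsI] Prop. 1.1 (1.89), (1.18) and [King1986] (4.38) are the cited inputs of those leaves;
nothing printed is a hypothesis).
HONEST FRAMING (cell contract, verbatim): «discharging `BetaPertH` makes Bałaban's UV stability UNCONDITIONAL — a real constructive-QFT result; it is NOT the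
continuum limit and NOT the Clay problem.»  HONEST DEPENDENCY (verbatim): «continuum YM on T⁴ ⇐ BetaPertH ∧ nine spine estimates (0/9 proved); BetaPertH ⇐
(D1) ∧ (D4) ∧ CAP+tail; G-an2-4 gates asym, D1 and NE2/3/4.»

WHY (census V202′ (b′)).  Gen 62 located the indicator family's geometric step envelope (L-SR) as the one analysis item left: the resolvent route's left (H-bd) letter
`‖𝒢·diag(𝟙_B)∇‖` is unbounded.  PART 217 replaced that route for the single insertion word by the PLANTED laws of the two items `𝒢` and `∇_{μ₀}𝒢` and the EXACT nesting
`diag(V′)J = J·diag(V)` (`V′ = V ∘ par`, `JK_mul_diagonal`), PART 218 typed the derivative item's two letters from the tree's King laws; this file assembles them on Bałaban's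
tower (`freeTowerLaws_balaban`: `Ã = √(L^d)·QB`, `J = JpcT`, `F = FQB`) — `TowerLimitRate … (k ↦ 𝒢_kP_k𝒢_k) C L^{−1}` for `P_k = diag(V^{(k)}_{μ₀})∇^{(k)}_{μ₀}`, `V` merely BOUNDED and
NESTED — and interpolates with PART 198's bounded (L-UD) exactly as PART 198 §4 did for Lipschitz backgrounds (`decayRate_of_towerLimitRate`): the two leg envelopes of PARTs
197 ∕ 200 ∕ 203 ∕ 208 for nested bounded single-direction families, constants depending on `(d, L, a, α, c₀)` only.

WHAT THIS FILE PROVES (0 sorry, 0 `def`; `M` any torus, `i` a unit bond, `μ₀` the derivative direction; `V^{(k)}_μ : idx L M k → ℂ` with `V^{(k)}_μ = 0` for `μ ≠ μ₀`):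
* §1 `Pmodel_single` (`P_k = diag(V^{(k)}_{μ₀})·∇^{(k)}_{μ₀}` for a single-direction family), `diagonal_nested` (`diag(V^{(k+1)}_{μ₀}) = diag(V^{(k)}_{μ₀} ∘ parT)`).
* §2 **`towerLimitRate_nestedWord`** — `L ≥ 2`, `‖V‖ ≤ α`, single direction, nested ⟹ `TowerLimitRate (QBlev L M) (L^d) (k ↦ 𝒢_kP_k𝒢_k) (αCst(CJ + CQL + 4dCst + 2dLCst)) L^{−1}`
  on EVERY torus (operator norm on the unit lattice; no smoothness).
* §3 **`exists_twoPoint_insertion_rate_nested`** — `∃ κ > 0, B, B′ ≥ 0` from `(d, L, a, α, c₀)`: for EVERY torus, unit bond `i`, and every bounded single-direction NESTED family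
  supported where `ρ_{k,i} ≤ c₀`: `‖X_{i,k}(x,y)‖ ≤ B·e^{−κ(distK x i + distK y i)}` and `‖(X_{i,k+1} − X_{i,k})(x,y)‖ ≤ B′·(√(L⁻¹))^k·e^{−κ(…)}` — PART 198 §4's shape, the
  `LipschitzBackground` hypothesis REPLACED by boundedness + nesting.
WHAT IT DOES NOT DO: the two-vertex word `[i,j]` (needs the planted law for a word with TWO insertions — same pattern, next); the socket ENDs for nested indicator families (PART 208
§2's generic-leg sockets + PART 213's EL₃ then give T₁–T₃'s whole LimitRate END — bookkeeping, next); backgrounds that are not exactly nested (the `ρ ≤ 0` balls of PART 213 §4 are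
nested only up to a boundary layer).
SUPPLIER work; NEVER «G-an2-4 closed»; NOT (CONV-C), NOT D1, NOT `BetaPertH`, NOT continuum, NOT Clay.  Records: `HOME/b2b-balaban-gan24-p3/gen63/README.md`.
-/

noncomputable section

open scoped BigOperators ComplexConjugate Matrix Matrix.Norms.L2Operator
open Filter Topology

namespace Summit.QuantumFields.BalabanUV.Beta.GAN24.NestedBackgroundWordRate

open Literature.MathematicalPhysics.QuantumFieldTheory.Balaban1983to89
open Literature.MathematicalPhysics.QuantumFieldTheory.Balaban1983to89.B5Prop11Plancherel (Tor fine Cst Cst_nonneg fdiff calG opNorm_calG_le opNorm_fdiff_calG_le)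
open Literature.MathematicalPhysics.QuantumFieldTheory.Balaban1983to89.B5G183RateTorusW (CQL)
open Literature.MathematicalPhysics.QuantumFieldTheory.Balaban1983to89.B5G183RateUnitTower (lev)
open Summit.QuantumFields.BalabanUV.T4Continuum
open Summit.QuantumFields.BalabanUV.T4Continuum.CovariantAveragingTower (avgTow TowerLimitRate)
open Summit.QuantumFields.BalabanUV.T4Continuum.BalabanAveragedTowerUnit (idx QBlev calGlev one_le_lev')
open Summit.QuantumFields.BalabanUV.T4Continuum.BalabanAveragingPairing (FQBlev freeTowerLaws_balaban)
open Summit.QuantumFields.BalabanUV.T4Continuum.KingPairingPlantedLaw (JpcT calDalev calDalev_inv CJ CJ_nonneg JK_conjTranspose_mul_JK)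
open Summit.QuantumFields.BalabanUV.T4Continuum.BlockPairingGeometry (parT JK_mul_diagonal opNorm_diagonal_le)
open Summit.QuantumFields.BalabanUV.T4Continuum.FirstOrderBackgroundModel (Pmodel firstOrder)
open Summit.QuantumFields.BalabanUV.T4Continuum.CTKingTowerWeights (rho distK)
open Summit.QuantumFields.BalabanUV.T4Continuum.DecayRateInterpolation (EntryDecay TwoLevelDecayRate decayRate_of_towerLimitRate)
open Summit.QuantumFields.BalabanUV.Beta.GAN24.UnitLatticeDecayAlgebra (distK_nonneg)
open Summit.QuantumFields.BalabanUV.Beta.GAN24.InsertionWordTwoPointDecay (exists_twoPoint_insertion)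
open Summit.QuantumFields.BalabanUV.Beta.GAN24.PlantedWordLaw (towerLimitRate_plantedWord)
open Summit.QuantumFields.BalabanUV.Beta.GAN24.DerivativeItemPlantedLaw (plantedG_le_lev plantedW_le_lev pairingW_le_lev)

variable {d : ℕ} (L : ℕ) [NeZero L] (M : Fin d → ℕ) [hM : ∀ μ, NeZero (M μ)] (a : ℝ) (ha : 0 < a)

/-! ## §1 Single-direction families: `P_k = diag(V^{(k)}_{μ₀})∇^{(k)}_{μ₀}`; nested diagonals -/

/-- for a single-direction family (`V^{(k)}_μ = 0` for `μ ≠ μ₀`) the model perturbation is ONE product `diag(V^{(k)}_{μ₀})·∇^{(k)}_{μ₀}`. [folklore] -/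
theorem Pmodel_single {V : (k : ℕ) → Fin d → (idx L M k → ℂ)} {μ₀ : Fin d} (hdir : ∀ k μ u, μ ≠ μ₀ → V k μ u = 0) (k : ℕ) :
    Pmodel L M V k = Matrix.diagonal (V k μ₀) * fdiff (fine (lev L k) M) ((lev L k : ℕ) : ℂ) μ₀ := by
  unfold Pmodel firstOrder
  rw [Finset.sum_eq_single μ₀]
  · intro μ _ hμ
    have h0 : V k μ = 0 := funext fun u => hdir k μ u hμ
    rw [h0]
    simp
  · intro h; exact absurd (Finset.mem_univ μ₀) h

omit [NeZero L] hM in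
/-- nesting of the values is nesting of the diagonals: `diag(V^{(k+1)}_{μ₀}) = diag(V^{(k)}_{μ₀} ∘ parT)`. [folklore] -/
theorem diagonal_nested {V : (k : ℕ) → Fin d → (idx L M k → ℂ)} {μ₀ : Fin d} (hnest : ∀ k (u : idx L M (k + 1)), V (k + 1) μ₀ u = V k μ₀ (parT (lev L k) L M u)) (k : ℕ) :
    Matrix.diagonal (V (k + 1) μ₀) = Matrix.diagonal (V k μ₀ ∘ parT (lev L k) L M) :=
  congrArg Matrix.diagonal (funext fun u => hnest k u)

/-! ## §2 The tower rate of the word in operator norm, for bounded nested single-direction backgrounds -/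

/-- **`towerLimitRate_nestedWord` — THE INSERTION WORD OF A BOUNDED NESTED BACKGROUND CONVERGES ALONG BAŁABAN's TOWER WITH RATE `L^{−k}` IN OPERATOR NORM**
[our proof] (`L ≥ 2`; `‖V^{(k)}_μ(u)‖ ≤ α`, `V^{(k)}_μ = 0` for `μ ≠ μ₀`, `V^{(k+1)}_{μ₀} = V^{(k)}_{μ₀} ∘ parT`; EVERY torus): `TowerLimitRate (QBlev L M) (L^d) (k ↦ 𝒢_kP_k𝒢_k)
(αCst·CJ + Cst·α·(CQL + 4dCst) + αCst·dLCst + Cst·α·dLCst) L^{−1}` — PART 217's planted word law on `freeTowerLaws_balaban` with PART 218's letters; NO smoothness of `V`. -/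
theorem towerLimitRate_nestedWord (hL : 2 ≤ L) {α : ℝ} (hα : 0 ≤ α) {V : (k : ℕ) → Fin d → (idx L M k → ℂ)} {μ₀ : Fin d}
    (hVb : ∀ k μ u, ‖V k μ u‖ ≤ α) (hdir : ∀ k μ u, μ ≠ μ₀ → V k μ u = 0) (hnest : ∀ k (u : idx L M (k + 1)), V (k + 1) μ₀ u = V k μ₀ (parT (lev L k) L M u)) :
    TowerLimitRate (QBlev L M) ((L : ℝ) ^ d) (fun k => calGlev L M a ha k * Pmodel L M V k * calGlev L M a ha k)
      (α * Cst d a * CJ d a + Cst d a * α * (CQL d a + 4 * d * Cst d a) + α * Cst d a * (d * L * Cst d a) + Cst d a * α * (d * L * Cst d a)) ((L : ℝ)⁻¹) := by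
  have hL1 : (1 : ℝ) < L := by exact_mod_cast (lt_of_lt_of_le one_lt_two hL : 1 < L)
  have hr : (0 : ℝ) < (L : ℝ) ^ d := pow_pos (lt_trans zero_lt_one hL1) d
  have hρ1 : ((L : ℝ)⁻¹) < 1 := inv_lt_one_of_one_lt₀ hL1
  have hT := towerLimitRate_plantedWord (Δ := calDalev L M a ha) (Dm := fun k => Matrix.diagonal (V k μ₀))
    (W := fun k => fdiff (fine (lev L k) M) ((lev L k : ℕ) : ℂ) μ₀ * (calDalev L M a ha k)⁻¹) hr (freeTowerLaws_balaban L M a ha)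
    (fun k => JK_conjTranspose_mul_JK (lev L k) L M)
    (fun k => by
      show Matrix.diagonal (V (k + 1) μ₀) * JpcT L M k = JpcT L M k * Matrix.diagonal (V k μ₀)
      rw [diagonal_nested L M hnest k]
      exact (JK_mul_diagonal (lev L k) L M (V k μ₀)).symm)
    (fun k => by rw [calDalev_inv]; exact opNorm_calG_le (lev L k) (one_le_lev' L k) M a ha)
    (fun k => opNorm_diagonal_le (fine (lev L k) M) hα fun u => hVb k μ₀ u)
    (fun k => by rw [calDalev_inv]; exact opNorm_fdiff_calG_le (lev L k) (one_le_lev' L k) M a ha μ₀)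
    (fun k => by rw [calDalev_inv, calDalev_inv]; exact plantedG_le_lev L M a ha k)
    (fun k => by rw [calDalev_inv, calDalev_inv]; exact plantedW_le_lev L M a ha k μ₀)
    (fun k => by rw [calDalev_inv]; exact pairingW_le_lev L M a ha k μ₀)
    hρ1 (fun k => le_rfl) (fun k => le_rfl) (fun k => le_rfl) (fun k => le_rfl)
  have e : (fun k => (calDalev L M a ha k)⁻¹ * Matrix.diagonal (V k μ₀) * (fdiff (fine (lev L k) M) ((lev L k : ℕ) : ℂ) μ₀ * (calDalev L M a ha k)⁻¹))
      = fun k => calGlev L M a ha k * Pmodel L M V k * calGlev L M a ha k := by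
    funext k; rw [calDalev_inv, Pmodel_single L M hdir k]; simp only [Matrix.mul_assoc]
  rw [e] at hT
  exact hT

/-! ## §3 (L-UD)+(L-SR) for bounded nested single-direction families: PART 198 §4 without the Lipschitz letter -/

/-- **`exists_twoPoint_insertion_rate_nested` — THE TWO LEG ENVELOPES OF THE SINGLE-INSERTION WORD OF A BOUNDED, NESTED, LOCALISED SINGLE-DIRECTION BACKGROUND, VOLUME-FREE**
[our proof] (`L ≥ 2`, `α ≥ 0`, `c₀` arbitrary, direction `μ₀`): `∃ κ > 0, B, B′ ≥ 0` depending on `(d, L, a, α, c₀)` only such that for EVERY torus `M`, EVERY unit bond `i`, EVERY family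
with `‖V^{(k)}_μ(u)‖ ≤ α`, `V^{(k)}_μ = 0` (`μ ≠ μ₀`), `V^{(k+1)}_{μ₀} = V^{(k)}_{μ₀} ∘ parT` and `V^{(k)}_μ(u) ≠ 0 ⟹ ρ_{k,i}(u) ≤ c₀`, and all `k, x, y`:
`‖X_{i,k}(x,y)‖ ≤ B·e^{−κ(distK(x,i) + distK(y,i))}` and `‖(X_{i,k+1} − X_{i,k})(x,y)‖ ≤ B′·(√(L⁻¹))^k·e^{−κ(distK(x,i) + distK(y,i))}` — PART 198 §3's (L-UD) interpolated with §2's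
operator-norm tower rate by `decayRate_of_towerLimitRate`.  The INDICATOR of any union of unit blocks in one coordinate direction qualifies (`α = 1`). -/
theorem exists_twoPoint_insertion_rate_nested (hL : 2 ≤ L) (α c₀ : ℝ) (hα : 0 ≤ α) (μ₀ : Fin d) :
    ∃ κ B B' : ℝ, 0 < κ ∧ 0 ≤ B ∧ 0 ≤ B' ∧ ∀ (M : Fin d → ℕ) [∀ μ, NeZero (M μ)] (i : idx L M 0) (V : (k : ℕ) → Fin d → (idx L M k → ℂ)),
      (∀ k μ u, ‖V k μ u‖ ≤ α) → (∀ k μ u, μ ≠ μ₀ → V k μ u = 0) → (∀ k (u : idx L M (k + 1)), V (k + 1) μ₀ u = V k μ₀ (parT (lev L k) L M u)) →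
      (∀ k μ u, V k μ u ≠ 0 → rho L M k i u ≤ c₀) →
      (∀ k x y, ‖avgTow (QBlev L M) ((L : ℝ) ^ d) (fun k => calGlev L M a ha k * Pmodel L M V k * calGlev L M a ha k) k x y‖
        ≤ B * Real.exp (-(κ * (distK L M x i + distK L M y i)))) ∧
      (∀ k x y, ‖(avgTow (QBlev L M) ((L : ℝ) ^ d) (fun k => calGlev L M a ha k * Pmodel L M V k * calGlev L M a ha k) (k + 1)
          - avgTow (QBlev L M) ((L : ℝ) ^ d) (fun k => calGlev L M a ha k * Pmodel L M V k * calGlev L M a ha k) k) x y‖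
        ≤ B' * Real.sqrt ((L : ℝ)⁻¹) ^ k * Real.exp (-(κ * (distK L M x i + distK L M y i)))) := by
  obtain ⟨κ, B, hκ0, hB, hUD⟩ := exists_twoPoint_insertion L a ha α c₀ hα
  set C : ℝ := α * Cst d a * CJ d a + Cst d a * α * (CQL d a + 4 * d * Cst d a) + α * Cst d a * (d * L * Cst d a) + Cst d a * α * (d * L * Cst d a) with hCdef
  have hL1 : (1 : ℝ) < L := by exact_mod_cast (lt_of_lt_of_le one_lt_two hL : 1 < L)
  have hρ0 : (0 : ℝ) ≤ (L : ℝ)⁻¹ := inv_nonneg.mpr (Nat.cast_nonneg _)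
  have hρ1 : ((L : ℝ)⁻¹) < 1 := inv_lt_one_of_one_lt₀ hL1
  have hCst := Cst_nonneg d a
  have hCJ := CJ_nonneg d a
  have hCQL : 0 ≤ CQL d a + 4 * d * Cst d a := by
    -- the constant bounds a norm (PART 218's planted law at `k = 0` on the one-point torus)
    have h := plantedW_le_lev L (fun _ : Fin d => 1) a ha 0 μ₀
    rw [pow_zero, mul_one] at h
    exact (norm_nonneg _).trans h
  have hC0 : 0 ≤ C := by positivity
  refine ⟨κ / 2, B, Real.sqrt (2 * B * (2 * C / (1 - (L : ℝ)⁻¹))), half_pos hκ0, hB, Real.sqrt_nonneg _, fun M _ i V hVb hdir hnest hloc => ?_⟩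
  have hT := towerLimitRate_nestedWord L M a ha hL hα hVb hdir hnest
  have hdec : ∀ k, EntryDecay (fun x y => distK L M x i + distK L M y i)
      (avgTow (QBlev L M) ((L : ℝ) ^ d) (fun k => calGlev L M a ha k * Pmodel L M V k * calGlev L M a ha k) k) B κ :=
    fun k x y => hUD M i V hVb hloc k x y
  obtain ⟨clim, -, -, -, hstep⟩ := decayRate_of_towerLimitRate hρ0 hρ1 hC0 hT hdec
  refine ⟨fun k x y => (hUD M i V hVb hloc k x y).trans (mul_le_mul_of_nonneg_left (Real.exp_le_exp.mpr ?_) hB), fun k x y => hstep k x y⟩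
  have h0 : 0 ≤ distK L M x i + distK L M y i := add_nonneg (distK_nonneg L M _ _) (distK_nonneg L M _ _)
  nlinarith

end Summit.QuantumFields.BalabanUV.Beta.GAN24.NestedBackgroundWordRate

end
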